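import Summits.AnomalousDissipation.AnomalousDissipation.Theorems.SawtoothPulseCascadeK1LocalisedCascadeCanonicalRatioStepsLog2

/-!
# K1loc, line `Spectral` / thin start — helper: THE (A-V) STEP OF THE SHELL CHAIN AT AN ARBITRARY THRESHOLD (numeric layer)

Helper file of the prover lane on the crux `K1LocalisedCascade` (stmt-AnomalousDissipation-19491), route `SawtoothPulseCascade`
(S-B/S-C assembly seat; the LEDGER ASSEMBLY, numeric layer; second instance after `…PhaseTH`).  The shell class
`A_i(Y) = Σ'[Y ≤ |k₀| ∧ |k₀| ≤ 2|k₁|]‖𝓕a_i‖²` feeds the sub-cone classes of the ledger; its chain (κ = 1) is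
`√A_{i+1}(Y) ≤ √A_i(Y) + ω_i(Y)` from (A-V) + (B-H) (`K1Ledger.From.sqrt_shell_escalation_step`), capped a few phases back by the far
tail.  This file is the (A-V) half at an ARBITRARY threshold `Y ≥ 12`: `ratioClass_vstep_canonicalLog2_le` with class slope `(1,2)`,
`X = Y`, fibre floor `Λ₀ = ⌊Y/2⌋`, margin `β = 4`, the `max` family with `Y₀ = Y − 1`, slope bound `t = 2` (so `r* ≤ 37/11`, gap `≥ 11`),
feed `B_i(Y) = Σ'[Y ≤ |k₀| ∧ |k₁| ≤ 2|k₀|]‖𝓕b_i‖²`, `M_b = 7i + 20`, `η = ε/(A₁·8π·2^20·⌊Y/2⌋)·64^{−i}`: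
  `A_{i+1}(Y) ≤ (√J_A(i,Y) + √B_i(Y))² + ((1+γ)^{2(i+1)}/(⌊Y/2⌋·2^{7i+20}))²`,
  `J_A(i,Y) = 3r₁²((4/3)ε² + 32·2^i·A₁/⌊Y/2⌋ + 8(7i+20)A₁²(M·δ_i)/π)`, `r₁ = 4/π + (2/π)log(37/11) + 1/11 + 1/(121π)`,
  `A₁ = 4/π + (2/π)log 7 + 1/12 + 1/(144π)`.  No definitions; no statement about the crux.
[cite: Grafakos2014, Prop. 3.1.2 (5), Prop. 3.2.7 (3), §3.1.3] [cite: ElgindiLissMattingly2025, §1 (slope ±1 branches)] [problem: turb]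
-/

-- `Summit.<Summit>.<Problem>`: single-conjunct summit, the duplicate namespace segment is deliberate.
set_option linter.dupNamespace false

noncomputable section

namespace Summit.AnomalousDissipation.AnomalousDissipation.Theorems.SawtoothPulseCascade.K1Window

open MeasureTheory Set Filter Topology UnitAddTorus Function Complex Metric
open scoped Real ENNReal
open Literature.Analysis Literature.Analysis.FunctionSpaces Literature.Analysis.FunctionSpaces.Torus Literature.Analysis.FluidPDE
open Literature.Analysis.FluidPDE.ShearStage
open Literature.Analysis.FluidPDE.SawtoothCascade Literature.Analysis.FluidPDE.SawtoothCascade.CascadeParams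
open Summit.AnomalousDissipation.AnomalousDissipation.Theorems.SawtoothPulseCascade.K1Start
open Summit.AnomalousDissipation.AnomalousDissipation.Theorems.SawtoothPulseCascade.K1Flat
open Summit.AnomalousDissipation.AnomalousDissipation.Theorems.SawtoothPulseCascade.K1Ledger.From

/-- **The log cut-off ratio of the (A-V) blocks is at most `r₁ = 4/π + (2/π)log(37/11) + 1/11 + 1/(121π)`** (max family with
`Y₀ = Y − 1`, `t = 2`, `β = 4`, floor `Λ₀ = ⌊Y/2⌋ ≥ 6`). [folklore] -/
theorem shell_logCutoff_le {Y : ℕ} (hY : 12 ≤ Y) (m : ℕ) :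
    4 / π + 2 / π * Real.log ((((max (2 * 1 * (Y / 2 * 2 ^ m) / 2) (Y - 1) : ℕ) : ℝ) + ((4 * (Y / 2 * 2 ^ m) / 1 : ℕ) : ℝ)) /
        (((4 * (Y / 2 * 2 ^ m) / 1 : ℕ) : ℝ) - ((max (2 * 1 * (Y / 2 * 2 ^ m) / 2) (Y - 1) : ℕ) : ℝ))) +
      1 / (((4 * (Y / 2 * 2 ^ m) / 1 : ℕ) : ℝ) - ((max (2 * 1 * (Y / 2 * 2 ^ m) / 2) (Y - 1) : ℕ) : ℝ)) +
      1 / (π * (((4 * (Y / 2 * 2 ^ m) / 1 : ℕ) : ℝ) - ((max (2 * 1 * (Y / 2 * 2 ^ m) / 2) (Y - 1) : ℕ) : ℝ)) ^ 2) ≤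
    4 / π + 2 / π * Real.log (37 / 11) + 1 / 11 + 1 / (π * 11 ^ 2) := by
  have hΛ0 : 6 ≤ Y / 2 := by omega
  have h1 : 2 * 1 * 1 ≤ 2 * 2 := by norm_num
  have h2 : (Y - 1) * 1 ≤ 2 * (Y / 2) := by omega
  have h3 : 2 * 1 * (Y / 2) + 2 * 1 * 1 ≤ 4 * 1 * (Y / 2) := by omega
  have hQ := canonMax_Q₁_lt_Q₂ (u' := 1) (v' := 2) (Y₀ := Y - 1) (tn := 2) (td := 1) (qn := 4) (qd := 1) (Λ0 := Y / 2)
    (by norm_num) (by norm_num) (by norm_num) h1 h2 h3 m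
  have hr := canonMax_r_le (u' := 1) (v' := 2) (Y₀ := Y - 1) (tn := 2) (td := 1) (qn := 4) (qd := 1) (Λ0 := Y / 2)
    (by norm_num) (by norm_num) (by norm_num) h1 h2 h3 m
  have hgap := canonMax_gap_le (u' := 1) (v' := 2) (Y₀ := Y - 1) (tn := 2) (td := 1) (qn := 4) (qd := 1) (Λ0 := Y / 2)
    (by norm_num) (by norm_num) (by norm_num) h1 h2 h3 m
  have hΛ0r : (6 : ℝ) ≤ ((Y / 2 : ℕ) : ℝ) := by exact_mod_cast hΛ0
  have hden : (0 : ℝ) < (((4 : ℕ) : ℝ) / ((1 : ℕ) : ℝ) - ((2 : ℕ) : ℝ) / ((1 : ℕ) : ℝ)) * ((Y / 2 : ℕ) : ℝ) - 1 := by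
    push_cast; linarith
  have hrs : ((((2 : ℕ) : ℝ) / ((1 : ℕ) : ℝ) + ((4 : ℕ) : ℝ) / ((1 : ℕ) : ℝ)) * ((Y / 2 : ℕ) : ℝ) + 1) /
      ((((4 : ℕ) : ℝ) / ((1 : ℕ) : ℝ) - ((2 : ℕ) : ℝ) / ((1 : ℕ) : ℝ)) * ((Y / 2 : ℕ) : ℝ) - 1) ≤ 37 / 11 := by
    rw [div_le_iff₀ hden]
    push_cast; linarith
  have hgap11 : (11 : ℝ) ≤ (((4 : ℕ) : ℝ) / ((1 : ℕ) : ℝ) - ((2 : ℕ) : ℝ) / ((1 : ℕ) : ℝ)) * ((Y / 2 : ℕ) : ℝ) - 1 := by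
    push_cast; linarith
  have h := logCutoff_le_of_gap hQ hr (by norm_num : (0 : ℝ) < 11) (hgap11.trans hgap)
  refine h.trans ?_
  have hpos : 0 < ((((2 : ℕ) : ℝ) / ((1 : ℕ) : ℝ) + ((4 : ℕ) : ℝ) / ((1 : ℕ) : ℝ)) * ((Y / 2 : ℕ) : ℝ) + 1) /
      ((((4 : ℕ) : ℝ) / ((1 : ℕ) : ℝ) - ((2 : ℕ) : ℝ) / ((1 : ℕ) : ℝ)) * ((Y / 2 : ℕ) : ℝ) - 1) := by
    refine div_pos ?_ hden
    push_cast; linarith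
  exact logKernel_mono hpos hrs (by norm_num) le_rfl

section Cascade

variable (P : CascadeParams)

set_option maxHeartbeats 400000 in
/-- **(A-V) AT THRESHOLD `Y ≥ 12`, PHASE `i`** (see the file header): the shell class of `a_{i+1}` above `Y` is fed by the shallow
class `B_i(Y)` of `b_i` plus the closed-form Log2 junk `J_A(i,Y)` plus the far tail. [cite: Grafakos2014, Prop. 3.1.2 (5), Prop. 3.2.7 (3), §3.1.3] -/
theorem shell_vstep_fat_le (hγ : P.γ = 8) (hδ₀ : 0 < P.δ₀) (hd : P.d = 2) (hN₀ : P.N₀ = 1) (hρN : P.ρN = 2)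
    (a b : ℕ → UnitAddTorus (Fin 2) → ℝ) (has : ∀ j, IsSmooth (a j)) (h0 : a 0 = datum)
    (hb : ∀ j, b j = a j ∘ shearMap 0 1 (amp ⟨P.U j, P.U_periodic j, P.contDiff_U (P.δ_pos hδ₀ (by rw [hd]; norm_num) j)⟩ P.γ))
    (hab : ∀ j, a (j + 1) = b j ∘ shearMap 1 0 (amp ⟨P.U j, P.U_periodic j, P.contDiff_U (P.δ_pos hδ₀ (by rw [hd]; norm_num) j)⟩ P.γ))
    {Y : ℕ} (hY : 12 ≤ Y) {ε : ℝ} (hε : 0 < ε) (i : ℕ)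
    (hMδ : max 1 (Real.sqrt (2 * Real.log (1 / (ε / ((4 / π + 2 / π * Real.log 7 + 1 / 12 + 1 / (π * 12 ^ 2)) * π * 8 *
        2 ^ 20 * ((Y / 2 : ℕ) : ℝ)) * (1 / 64) ^ i)))) * P.δ i < π / 2) :
    ∑' k : Fin 2 → ℤ, (if (Y : ℤ) ≤ |k 0| ∧ ((1 : ℕ) : ℤ) * |k 0| ≤ ((2 : ℕ) : ℤ) * |k 1| then (1 : ℝ) else 0) *
        ‖mFourierCoeff (fun x => (a (i + 1) x : ℂ)) k‖ ^ 2 ≤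
      (Real.sqrt (3 * (4 / π + 2 / π * Real.log (37 / 11) + 1 / 11 + 1 / (π * 11 ^ 2)) ^ 2 *
            (4 / 3 * ε ^ 2 + 32 * 2 ^ i * (4 / π + 2 / π * Real.log 7 + 1 / 12 + 1 / (π * 12 ^ 2)) / ((Y / 2 : ℕ) : ℝ) +
              8 * ((7 * i + 20 : ℕ) : ℝ) * (4 / π + 2 / π * Real.log 7 + 1 / 12 + 1 / (π * 12 ^ 2)) ^ 2 *
                (max 1 (Real.sqrt (2 * Real.log (1 / (ε / ((4 / π + 2 / π * Real.log 7 + 1 / 12 + 1 / (π * 12 ^ 2)) * π * 8 *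
                  2 ^ 20 * ((Y / 2 : ℕ) : ℝ)) * (1 / 64) ^ i)))) * P.δ i) / π)) +
          Real.sqrt (∑' k : Fin 2 → ℤ, (if (Y : ℤ) ≤ |k 0| ∧ ((1 : ℕ) : ℤ) * |k 1| ≤ ((2 : ℕ) : ℤ) * |k 0| then (1 : ℝ) else 0) *
            ‖mFourierCoeff (fun x => (b i x : ℂ)) k‖ ^ 2)) ^ 2 +
        ((1 + P.γ) ^ (2 * (i + 1)) / (((Y / 2) * 2 ^ (7 * i + 20) : ℕ) : ℝ)) ^ 2 := by
  set Λ0 : ℕ := Y / 2 with hΛ0def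
  have hΛ06 : 6 ≤ Λ0 := by rw [hΛ0def]; omega
  have hΛ01 : 1 ≤ Λ0 := le_trans (by norm_num) hΛ06
  have hΛ0r : (6 : ℝ) ≤ Λ0 := by exact_mod_cast hΛ06
  have hΛ0pos : (0 : ℝ) < Λ0 := by linarith
  have hγ' : P.γ = ((8 : ℕ) : ℝ) := by rw [hγ]; norm_num
  have hd' : 0 < P.d := by rw [hd]; norm_num
  have hN₀' : 1 ≤ P.N₀ := by rw [hN₀]
  have hρN' : 1 ≤ P.ρN := by rw [hρN]; norm_num
  have hNi : (P.N i : ℝ) = 2 ^ i := by rw [CascadeParams.N, hN₀, hρN]; push_cast; ring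
  have hΛX : 2 * Λ0 ≤ 1 * Y := by rw [hΛ0def]; omega
  have h1 : 2 * 1 * 1 ≤ 2 * 2 := by norm_num
  have h2 : (Y - 1) * 1 ≤ 2 * Λ0 := by rw [hΛ0def]; omega
  have h3 : 2 * 1 * Λ0 + 2 * 1 * 1 ≤ 4 * 1 * Λ0 := by omega
  set A₁ : ℝ := 4 / π + 2 / π * Real.log 7 + 1 / 12 + 1 / (π * 12 ^ 2) with hA₁
  set r₁ : ℝ := 4 / π + 2 / π * Real.log (37 / 11) + 1 / 11 + 1 / (π * 11 ^ 2) with hr₁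
  set η : ℝ := ε / (A₁ * π * 8 * 2 ^ 20 * (Λ0 : ℝ)) * (1 / 64) ^ i with hη
  have hπ := Real.pi_pos
  have hlog7 : 0 ≤ Real.log 7 := Real.log_nonneg (by norm_num)
  have hA₁pos : 0 < A₁ := by rw [hA₁]; positivity
  have hηpos : 0 < η := by rw [hη]; positivity
  -- the packaged step
  have hstep := ratioClass_vstep_canonicalLog2_le P hγ' hδ₀ hd' hN₀' hρN' a b has h0 hb hab i (u := 1) (v := 2) (X := Y)
    (u' := 1) (v' := 2) (Y := Y) (qn := 4) (qd := 1) (Λ0 := Λ0) (by norm_num) (by norm_num) (by norm_num) (by norm_num)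
    (by norm_num) hΛ01 hΛX (fun m => max (2 * 1 * (Λ0 * 2 ^ m) / 2) (Y - 1))
    (fun m => canonMax_Q₁_lt_Q₂ (by norm_num) (by norm_num) (by norm_num) h1 h2 h3 m)
    (fun m => canonMax_feed (by norm_num) (Y - 1) Λ0 m) (rs := r₁) (fun m => shell_logCutoff_le hY m)
    (fun m => le_trans (by omega) (canonMax_Y 1 2 (Y - 1) Λ0 m)) (7 * i + 20) hηpos hMδ
  -- the exact constants at `(u,v,q_n,q_d) = (1,2,4,1)`: log-argument `7`, `D₀ = 2Λ₀`, `τ₀ = 1/(4Λ₀)`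
  have eratio : ((((2 : ℕ) : ℝ) + ((1 : ℕ) : ℝ) * ((8 : ℕ) : ℝ)) * ((1 : ℕ) : ℝ) + ((1 : ℕ) : ℝ) * ((4 : ℕ) : ℝ)) /
      ((((1 : ℕ) : ℝ) * ((8 : ℕ) : ℝ) - ((2 : ℕ) : ℝ)) * ((1 : ℕ) : ℝ) - ((1 : ℕ) : ℝ) * ((4 : ℕ) : ℝ)) = 7 := by
    push_cast; norm_num
  have eD : ((((1 : ℕ) : ℝ) * ((8 : ℕ) : ℝ) - ((2 : ℕ) : ℝ)) * ((1 : ℕ) : ℝ) - ((1 : ℕ) : ℝ) * ((4 : ℕ) : ℝ)) * (Λ0 : ℝ) /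
      (((1 : ℕ) : ℝ) * ((1 : ℕ) : ℝ)) = 2 * (Λ0 : ℝ) := by
    push_cast; ring
  have eτ : ((1 : ℕ) : ℝ) * ((1 : ℕ) : ℝ) / (2 * (((((1 : ℕ) : ℝ) * ((8 : ℕ) : ℝ) - ((2 : ℕ) : ℝ)) * ((1 : ℕ) : ℝ) -
      ((1 : ℕ) : ℝ) * ((4 : ℕ) : ℝ)) * (Λ0 : ℝ))) = 1 / (4 * (Λ0 : ℝ)) := by
    push_cast; field_simp; ring
  set As : ℝ := 4 / π + 2 / π * Real.log (((((2 : ℕ) : ℝ) + ((1 : ℕ) : ℝ) * ((8 : ℕ) : ℝ)) * ((1 : ℕ) : ℝ) +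
      ((1 : ℕ) : ℝ) * ((4 : ℕ) : ℝ)) / ((((1 : ℕ) : ℝ) * ((8 : ℕ) : ℝ) - ((2 : ℕ) : ℝ)) * ((1 : ℕ) : ℝ) - ((1 : ℕ) : ℝ) * ((4 : ℕ) : ℝ))) +
      1 / (((((1 : ℕ) : ℝ) * ((8 : ℕ) : ℝ) - ((2 : ℕ) : ℝ)) * ((1 : ℕ) : ℝ) - ((1 : ℕ) : ℝ) * ((4 : ℕ) : ℝ)) * (Λ0 : ℝ) /
        (((1 : ℕ) : ℝ) * ((1 : ℕ) : ℝ))) +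
      1 / (π * (((((1 : ℕ) : ℝ) * ((8 : ℕ) : ℝ) - ((2 : ℕ) : ℝ)) * ((1 : ℕ) : ℝ) - ((1 : ℕ) : ℝ) * ((4 : ℕ) : ℝ)) * (Λ0 : ℝ) /
        (((1 : ℕ) : ℝ) * ((1 : ℕ) : ℝ))) ^ 2) with hAs
  have hAsle : As ≤ A₁ := by
    rw [hAs, eratio, eD, hA₁]
    have h12 : 1 / (2 * (Λ0 : ℝ)) ≤ 1 / 12 := one_div_le_one_div_of_le (by norm_num) (by linarith)
    have h144 : 1 / (π * (2 * (Λ0 : ℝ)) ^ 2) ≤ 1 / (π * 12 ^ 2) :=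
      one_div_le_one_div_of_le (by positivity)
        (mul_le_mul_of_nonneg_left (pow_le_pow_left₀ (by norm_num) (by linarith) 2) hπ.le)
    linarith
  have hAs0 : 0 ≤ As := by
    rw [hAs, eratio, eD]
    positivity
  set Mδ : ℝ := max 1 (Real.sqrt (2 * Real.log (1 / η))) * P.δ i with hMδdef
  have hMδ0 : 0 ≤ Mδ := by
    rw [hMδdef]
    exact mul_nonneg (le_trans zero_le_one (le_max_left _ _)) (P.δ_pos hδ₀ hd' i).le
  refine le_sq_sqrt_add_mono hstep ?_
  rw [eτ, hNi]
  have hX : As * π * ((8 : ℕ) : ℝ) * η * Λ0 / 2 ^ i * 2 ^ (7 * i + 20) = As * (ε / A₁) := by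
    have e2 : (2 : ℝ) ^ (7 * i + 20) = 2 ^ 20 * 128 ^ i := by
      rw [pow_add, pow_mul]; norm_num; ring
    have p1 : ((1 : ℝ) / 64) ^ i * (128 : ℝ) ^ i = (2 : ℝ) ^ i := by
      rw [← mul_pow]; norm_num
    have hne1 : A₁ * Real.pi * 8 * 2 ^ 20 * (Λ0 : ℝ) ≠ 0 := by positivity
    have hne2 : (2 : ℝ) ^ i ≠ 0 := pow_ne_zero _ two_ne_zero
    rw [hη, e2]
    push_cast
    calc As * π * 8 * (ε / (A₁ * π * 8 * 2 ^ 20 * (Λ0 : ℝ)) * (1 / 64) ^ i) * Λ0 / 2 ^ i * (2 ^ 20 * 128 ^ i)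
        = As * (ε / A₁) * ((A₁ * Real.pi * 8 * 2 ^ 20 * (Λ0 : ℝ)) / (A₁ * Real.pi * 8 * 2 ^ 20 * Λ0)) *
            ((((1 : ℝ) / 64) ^ i * 128 ^ i) / 2 ^ i) := by
          field_simp
      _ = As * (ε / A₁) := by rw [p1, div_self hne1, div_self hne2]; ring
  have hXle : As * π * ((8 : ℕ) : ℝ) * η * Λ0 / 2 ^ i * 2 ^ (7 * i + 20) ≤ ε := by
    rw [hX]
    calc As * (ε / A₁) ≤ A₁ * (ε / A₁) := mul_le_mul_of_nonneg_right hAsle (by positivity)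
      _ = ε := by field_simp
  have hX0 : 0 ≤ As * π * ((8 : ℕ) : ℝ) * η * Λ0 / 2 ^ i * 2 ^ (7 * i + 20) := by rw [hX]; positivity
  have hr₁0 : 0 ≤ 3 * r₁ ^ 2 := by positivity
  refine mul_le_mul_of_nonneg_left ?_ hr₁0
  refine add_le_add (add_le_add ?_ ?_) ?_
  · exact mul_le_mul_of_nonneg_left (pow_le_pow_left₀ hX0 hXle 2) (by norm_num)
  · rw [show (128 : ℝ) * 2 ^ i * As * (1 / (4 * (Λ0 : ℝ))) = 32 * 2 ^ i * As / Λ0 by field_simp; ring]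
    exact div_le_div_of_nonneg_right (mul_le_mul_of_nonneg_left hAsle (by positivity)) hΛ0pos.le
  · have : As ^ 2 ≤ A₁ ^ 2 := pow_le_pow_left₀ hAs0 hAsle 2
    have := mul_le_mul_of_nonneg_left (mul_le_mul_of_nonneg_right this hMδ0) (by positivity : (0 : ℝ) ≤ 8 * ((7 * i + 20 : ℕ) : ℝ))
    have e : ∀ A : ℝ, 8 * ((7 * i + 20 : ℕ) : ℝ) * A ^ 2 * Mδ / π = 8 * ((7 * i + 20 : ℕ) : ℝ) * (A ^ 2 * Mδ) / π := fun A => by ring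
    rw [e, e]
    exact div_le_div_of_nonneg_right this hπ.le

end Cascade

end Summit.AnomalousDissipation.AnomalousDissipation.Theorems.SawtoothPulseCascade.K1Window
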